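import Mathlib

/-!
# Kreĭn–Stewart definitization: definitions

Support definitions for the proof of
`Literature.Analysis.OperatorTheory.KreinDefinitization` (Kreĭn 1959; J. Stewart, *Functions
with a finite number of negative squares*, Canad. Math. Bull. 15 (1972), Thm. 3.1 with Thm. 2.4):
every smooth Hermitian `F : ℝ → ℂ` with at most `κ` negative squares is *definitized* by a
differential operator `P(-iD) P♯(-iD)` of order `≤ κ`.

Stewart's printed proof works in the Pontryagin space `Π_k` of `F` and invokes Naimark's
self-adjoint extension and Pontryagin's invariant-subspace theorem, none of which Mathlib has.
The proof vendored in this directory (`KreinStewart*.lean`, `KreinLangerDefinitizationProofs.lean`)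
replaces them by an elementary argument with the same architecture:

* `KreinStewartNegSquares`, `KreinStewartFiniteDim`: Hermitian forms `B` (Mathlib's
  `V →ₗ⋆[ℂ] V →ₗ[ℂ] ℂ`, conjugate-linear in the first argument) with at most `κ` negative squares
  (`NegSqLE`), and the finite-dimensional definitization of a `B`-symmetric operator by induction
  on the dimension via one eigenvector (the rôle of Pontryagin's theorem);
* `KreinStewartCompression`, `KreinStewartAbstract`: compression to finite-dimensional
  non-degenerate pieces (orthogonal families modulo the radical) and a compactness argument on the
  coefficient sphere give the *algebraic definitization theorem* `abs_definitization` for any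
  symmetric operator on any complex vector space with finitely many negative squares;
* `KreinStewartTranslationForm`: the translation-invariant form `BF F`
  of `F` on point masses `ℝ →₀ ℂ`, the bounded symmetric difference-quotient operators
  `SDOp η = (2iη)⁻¹ (U η - U (-η))` standing in for the generator `-i d/dx`, and the limit `η → 0⁺`
  of iterated symmetric difference quotients of a smooth function.

This file only holds the definitions (reviewed once); all theorems live in the sibling files.
-/

open scoped ComplexConjugate
open Module Polynomial

namespace Literature.Analysis.OperatorTheory.KreinStewart

variable {V : Type*} [AddCommGroup V] [Module ℂ V]

/-- A sesquilinear form on a complex vector space, conjugate-linear in the first argument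
(Mathlib's `V →ₗ⋆[ℂ] V →ₗ[ℂ] ℂ`). [folklore] -/
abbrev HForm (V : Type*) [AddCommGroup V] [Module ℂ V] := V →ₗ⋆[ℂ] V →ₗ[ℂ] ℂ

/-- The form `B` has **at most `κ` negative squares** on the set `S`: among any `κ + 1` vectors of
`S` some non-trivial linear combination `d` has `Re B d d ≥ 0`, i.e. no `(κ+1)`-dimensional
subspace spanned by vectors of `S` is negative definite. [folklore] -/
def NegSqLEOn (B : HForm V) (κ : ℕ) (S : Set V) : Prop :=
  ∀ u : Fin (κ + 1) → V, (∀ a, u a ∈ S) → ∃ w : Fin (κ + 1) → ℂ, w ≠ 0 ∧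
    0 ≤ (B (∑ a, w a • u a) (∑ a, w a • u a)).re

/-- The form `B` has at most `κ` negative squares (Kreĭn). [folklore] -/
def NegSqLE (B : HForm V) (κ : ℕ) : Prop := NegSqLEOn B κ Set.univ

/-- `A` is symmetric with respect to the form `B`. [folklore] -/
def IsSymOp (B : HForm V) (A : V →ₗ[ℂ] V) : Prop := ∀ x y, B (A x) y = B x (A y)

section Pullback

variable {W : Type*} [AddCommGroup W] [Module ℂ W]

/-- Pull-back of a form along a linear map. [folklore] -/
def pb (B : HForm V) (φ : W →ₗ[ℂ] V) : HForm W := (B.comp φ).compl₂ φ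

/-- Evaluation of the pull-back. [folklore] -/
@[simp]
theorem pb_apply (B : HForm V) (φ : W →ₗ[ℂ] V) (x y : W) : pb B φ x y = B (φ x) (φ y) := rfl

/-- The pull-back of a Hermitian form is Hermitian. [folklore] -/
theorem isSymm_pb {B : HForm V} (hB : B.IsSymm) (φ : W →ₗ[ℂ] V) : (pb B φ).IsSymm :=
  ⟨fun x y => hB.eq (φ x) (φ y)⟩

end Pullback

section Radical

variable {B : HForm V}

/-- The radical of the form. [folklore] -/
def rad (B : HForm V) : Submodule ℂ V := LinearMap.ker B

/-- Membership in the radical. [folklore] -/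
theorem mem_rad {x : V} : x ∈ rad B ↔ ∀ y, B x y = 0 := by
  simp [rad, LinearMap.mem_ker, LinearMap.ext_iff]

/-- Projection onto the span of a finite orthogonal family. [folklore] -/
noncomputable def proj (B : HForm V) (b : Finset V) (x : V) : V := ∑ p ∈ b, (B p x / B p p) • p

/-- A finite orthogonal family of non-isotropic vectors. [folklore] -/
def OrthFam (B : HForm V) (b : Finset V) : Prop :=
  (∀ p ∈ b, ∀ q ∈ b, p ≠ q → B p q = 0) ∧ ∀ p ∈ b, B p p ≠ 0

/-- The polynomial with a given coefficient vector. [folklore] -/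
noncomputable def toPoly {κ : ℕ} (c : Fin (κ + 1) → ℂ) : ℂ[X] :=
  ∑ j : Fin (κ + 1), monomial (j : ℕ) (c j)

/-- `toPoly` is the inverse of Mathlib's `degreeLTEquiv`. [folklore] -/
theorem toPoly_eq {κ : ℕ} (c : Fin (κ + 1) → ℂ) :
    toPoly c = ((degreeLTEquiv ℂ (κ + 1)).symm c : ℂ[X]) := rfl

end Radical

/-- The symmetric difference quotient with step `η`. [folklore] -/
noncomputable def SD (η : ℝ) (f : ℝ → ℂ) (u : ℝ) : ℂ := (f (u + η) - f (u - η)) / (2 * (η : ℂ))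

section Form

variable (F : ℝ → ℂ)

/-- The double sum `Σ_s Σ_t conj(x s) y t F(t - s)`. [folklore] -/
noncomputable def kf (x y : ℝ →₀ ℂ) : ℂ :=
  ∑ s ∈ x.support, ∑ t ∈ y.support, conj (x s) * y t * F (t - s)

/-- The double sum may be taken over any finite sets containing the supports. [folklore] -/
theorem kf_eq {x y : ℝ →₀ ℂ} {S S' : Finset ℝ} (hS : x.support ⊆ S) (hS' : y.support ⊆ S') :
    kf F x y = ∑ s ∈ S, ∑ t ∈ S', conj (x s) * y t * F (t - s) := by
  unfold kf
  have inner : ∀ s, ∑ t ∈ y.support, conj (x s) * y t * F (t - s)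
      = ∑ t ∈ S', conj (x s) * y t * F (t - s) := fun s =>
    Finset.sum_subset hS' fun t _ ht => by
      rw [Finsupp.notMem_support_iff.1 ht, mul_zero, zero_mul]
  simp_rw [inner]
  exact Finset.sum_subset hS fun s _ hs => by
    simp [Finsupp.notMem_support_iff.1 hs]

/-- The translation-invariant sesquilinear form of `F` on finitely supported functions
(point masses): `BF F x y = Σ_s Σ_t conj(x s) y t F(t - s)`. [folklore] -/
noncomputable def BF : HForm (ℝ →₀ ℂ) :=
  LinearMap.mk₂'ₛₗ (starRingEnd ℂ) (RingHom.id ℂ) (kf F)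
    (fun x₁ x₂ y => by
      classical
      rw [kf_eq F (Finsupp.support_add (g₁ := x₁) (g₂ := x₂)) subset_rfl,
        kf_eq F (Finset.subset_union_left (s₂ := x₂.support)) (subset_rfl (a := y.support)),
        kf_eq F (Finset.subset_union_right (s₁ := x₁.support)) (subset_rfl (a := y.support)),
        ← Finset.sum_add_distrib]
      refine Finset.sum_congr rfl fun s _ => ?_
      rw [← Finset.sum_add_distrib]
      refine Finset.sum_congr rfl fun t _ => ?_
      rw [Finsupp.add_apply, map_add]
      ring)
    (fun a x y => by
      rw [kf_eq F (Finsupp.support_smul (b := a) (g := x)) subset_rfl, kf, smul_eq_mul,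
        Finset.mul_sum]
      refine Finset.sum_congr rfl fun s _ => ?_
      rw [Finset.mul_sum]
      refine Finset.sum_congr rfl fun t _ => ?_
      rw [Finsupp.smul_apply, smul_eq_mul, map_mul]
      ring)
    (fun x y₁ y₂ => by
      classical
      rw [kf_eq F subset_rfl (Finsupp.support_add (g₁ := y₁) (g₂ := y₂)),
        kf_eq F (subset_rfl (a := x.support)) (Finset.subset_union_left (s₂ := y₂.support)),
        kf_eq F (subset_rfl (a := x.support)) (Finset.subset_union_right (s₁ := y₁.support)),
        ← Finset.sum_add_distrib]
      refine Finset.sum_congr rfl fun s _ => ?_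
      rw [← Finset.sum_add_distrib]
      refine Finset.sum_congr rfl fun t _ => ?_
      rw [Finsupp.add_apply]
      ring)
    (fun a x y => by
      rw [kf_eq F subset_rfl (Finsupp.support_smul (b := a) (g := y)), kf, RingHom.id_apply,
        smul_eq_mul, Finset.mul_sum]
      refine Finset.sum_congr rfl fun s _ => ?_
      rw [Finset.mul_sum]
      refine Finset.sum_congr rfl fun t _ => ?_
      rw [Finsupp.smul_apply, smul_eq_mul]
      ring)

/-- `BF` is the bundled version of `kf`. [folklore] -/
theorem BF_apply (x y : ℝ →₀ ℂ) : BF F x y = kf F x y := rfl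

/-- Translation by `a` on point masses. [folklore] -/
noncomputable def U (a : ℝ) : (ℝ →₀ ℂ) →ₗ[ℂ] (ℝ →₀ ℂ) :=
  Finsupp.lmapDomain ℂ ℂ fun s : ℝ => s + a

/-- The symmetric difference-quotient operator `SDOp η = (2iη)⁻¹ (U η - U (-η))`, a bounded
symmetric stand-in for the generator `-i d/dx` of the translation group. [folklore] -/
noncomputable def SDOp (η : ℝ) : (ℝ →₀ ℂ) →ₗ[ℂ] (ℝ →₀ ℂ) :=
  ((2 : ℂ) * Complex.I * η)⁻¹ • (U η - U (-η))

/-- Evaluation of `SDOp η`. [folklore] -/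
theorem SDOp_apply (η : ℝ) (x : ℝ →₀ ℂ) :
    SDOp η x = ((2 : ℂ) * Complex.I * η)⁻¹ • (U η x - U (-η) x) := rfl

end Form

end Literature.Analysis.OperatorTheory.KreinStewart
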